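import Literature.Analysis.FluidPDE.TorusLpOperatorFacts
import Literature.Analysis.FluidPDE.AntidivergenceL2
import Literature.Analysis.FunctionSpaces.TorusInvLaplacianGradientLp
import HarnessLib

/-!
# Discharge of `Torus.antidivergence_Lp_bound` (Cheskidov–Luo 2022, Thm. 7.3)

Analysis/FluidPDE proof file, sibling of the facts file `TorusLpOperatorFacts` (next to
`TorusLpOperatorFactsProofs` — the moment inequality —, `TorusLpOperatorFactsRieszFreqProofs` and
`TorusLpOperatorFactsCommutatorProofs`, which discharge the other facts of that file). The named fact
`Torus.antidivergence_Lp_bound d` — Cheskidov–Luo 2022, Thm. 7.3: for `d ≥ 2` and every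
`1 ≤ p ≤ ∞` there is `C` with `‖ℛv‖_{L^p(𝕋^d)} ≤ C‖v‖_{L^p(𝕋^d)}` for all smooth zero-mean `v`,
`ℛ` the De Lellis–Székelyhidi antidivergence `Torus.antidivergence` (`FluidPDE/Antidivergence`:
`(ℛv)ᵢⱼ = ∂ᵢΔ⁻¹vⱼ + ∂ⱼΔ⁻¹vᵢ - (d-1)⁻¹δᵢⱼ D + (2-d)(d-1)⁻¹ ∂ᵢ∂ⱼΔ⁻¹D`, `D = Σₗ ∂ₗΔ⁻¹vₗ`) — is
PROVED (`Torus.antidivergence_Lp_bound_holds`), along the printed proof ("We only show that the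
operator `Δ⁻¹Δ⁻¹∂ᵢ∂ⱼ∂ₖ` is bounded on `L^p(𝕋^d)` for `1 ≤ p ≤ ∞` since the argument applies also
to `Δ⁻¹∂ᵢ`. When `1 < p < ∞`, this follows from the boundedness of the Riesz transforms and the
Poincare inequality. When `p = ∞`, the Sobolev embedding `W^{1,d+1}(𝕋^d) ↪ L^∞(𝕋^d)` … where we
have used the boundedness of the Riesz transforms once again. When `p = 1`, … a duality approach
and … the boundedness in `L^∞` since integrating by parts yields `⟨Tf, φ⟩ = -⟨f, Tφ⟩`"):

* the order `-1` pieces `∂ᵢΔ⁻¹vⱼ` and `D` are handled by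
  `Torus.exists_eLpNorm_partialDeriv_invLaplacian_le` (`FunctionSpaces/TorusInvLaplacianGradientLp`,
  all `1 ≤ p ≤ ∞`);
* the third-order piece `∂ᵢ∂ⱼΔ⁻¹D = Σₗ Δ⁻²∂ᵢ∂ⱼ∂ₗvₗ` (`Torus.exists_eLpNorm_hessian_antidivPhi_le`):
  `1 < p < ∞` by the Calderón–Zygmund bound `Torus.eLpNorm_hessian_le_laplacian_holds` (`ΔΔ⁻¹D = D`,
  `D` has zero mean) and the order `-1` bound for `D`; `p = ∞` by
  `Torus.exists_enorm_partialDeriv_partialDeriv_le` (Morrey + Riesz at `q = d + 2`) and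
  `∂ₘD = Σₗ ∂ₘ∂ₗΔ⁻¹vₗ`, Calderón–Zygmund again; `p = 1` by duality
  (`Torus.eLpNorm_one_le_of_forall_integral_mul_le`) through the adjoint identity
  `∫ (∂ᵢ∂ⱼΔ⁻¹D) ψ = -Σₗ ∫ vₗ ∂ₗΔ⁻¹Δ⁻¹∂ⱼ∂ᵢψ` (`Torus.integral_hessian_antidivPhi_mul`) and the
  sup bound `Torus.exists_enorm_partialDeriv_invLaplacian_invLaplacian_le`;
* the entries and the tensor are assembled exactly as in the `L²` case (`AntidivergenceL2`).

The zero-mean hypothesis of the fact is not used: `ℛ` only sees `v - ∫v`, and the bounds hold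
for all smooth `v`.

## References

* A. Cheskidov, X. Luo, *Sharp nonuniqueness for the Navier–Stokes equations*, Invent. Math. 229
  (2022) 987–1054 = arXiv:2009.06596, §7.2 (App. B), Def. 7.2 and Thm. 7.3 with its proof.
  [`CheskidovLuo2022`]
-/

noncomputable section

open MeasureTheory Set Filter Function UnitAddTorus
open scoped ENNReal NNReal ContDiff

namespace Literature.Analysis.FluidPDE

namespace Torus

open FunctionSpaces FunctionSpaces.Torus

variable {d : Type*} [Fintype d] [DecidableEq d]
variable {v : UnitAddTorus d → EuclideanSpace ℝ d}

/-! ## Integration by parts -/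

omit [DecidableEq d] in
/-- Integration by parts on the torus: `∫ (∂ᵢa) b = -∫ a (∂ᵢb)` for smooth real `a`, `b` (private
copy of `Torus.integral_partialDeriv_mul_eq_neg_integral` of `TorusPressurePoisson` and of
`Torus.integral_partialDeriv_mul_eq_neg` of `OnsagerProofs`, whose heavy import closures are not
wanted here). [cite: Evans2010, App. C.2 Thm. 2] -/
private theorem integral_partialDeriv_mul_eq_neg' [DecidableEq d] {a b : UnitAddTorus d → ℝ}
    (ha : IsSmooth a) (hb : IsSmooth b) (i : d) :
    ∫ x, Torus.partialDeriv i a x * b x = -∫ x, a x * Torus.partialDeriv i b x := by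
  have hab : IsSmooth (fun y => a y * b y) := by
    unfold IsSmooth at ha hb ⊢; exact ha.mul hb
  have h0 : ∫ x, Torus.partialDeriv i (fun y => a y * b y) x = 0 := integral_partialDeriv_eq_zero_holds hab i
  have e : (fun x => Torus.partialDeriv i (fun y => a y * b y) x) =
      fun x => a x * Torus.partialDeriv i b x + Torus.partialDeriv i a x * b x :=
    funext fun x => partialDeriv_mul (ha.isContDiff (by simp)) (hb.isContDiff (by simp)) i x
  have hi1 : Integrable (fun x => a x * Torus.partialDeriv i b x) volume :=
    (ha.continuous.mul (hb.partialDeriv i).continuous).integrable_unitAddTorus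
  have hi2 : Integrable (fun x => Torus.partialDeriv i a x * b x) volume :=
    ((ha.partialDeriv i).continuous.mul hb.continuous).integrable_unitAddTorus
  rw [e, integral_add hi1 hi2] at h0
  linarith

/-! ## The order `-1` pieces: `∂ᵢΔ⁻¹vⱼ` and `D = Σₗ ∂ₗΔ⁻¹vₗ` -/

section OrderMinusOne

/-- `‖∂ᵢΔ⁻¹vⱼ‖_p ≤ K ‖v‖_p` from the scalar bound with constant `K`. [folklore] -/
theorem eLpNorm_partialDeriv_antidivPotential_le_of_bound {p : ℝ≥0∞} {K : ℝ≥0}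
    (hK : ∀ g : UnitAddTorus d → ℝ, IsSmooth g → ∀ i : d,
      eLpNorm (Torus.partialDeriv i (invLaplacian g)) p volume ≤ K * eLpNorm g p volume)
    (hv : IsSmooth v) (i j : d) :
    eLpNorm (Torus.partialDeriv i (antidivPotential v j)) p volume ≤ K * eLpNorm v p volume :=
  (hK (fun y => v y j) (hv.apply j) i).trans (mul_le_mul' le_rfl (eLpNorm_apply_le v j p))

/-- `‖D‖_p ≤ d K ‖v‖_p` for `D = Σₗ ∂ₗΔ⁻¹vₗ`, from the scalar bound with constant `K`. [folklore] -/
theorem eLpNorm_antidivDiv_le_of_bound {p : ℝ≥0∞} (hp : 1 ≤ p) {K : ℝ≥0}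
    (hK : ∀ g : UnitAddTorus d → ℝ, IsSmooth g → ∀ i : d,
      eLpNorm (Torus.partialDeriv i (invLaplacian g)) p volume ≤ K * eLpNorm g p volume)
    (hv : IsSmooth v) :
    eLpNorm (antidivDiv v) p volume ≤ (Fintype.card d * K : ℝ≥0) * eLpNorm v p volume := by
  have hmeas : ∀ l, AEStronglyMeasurable (Torus.partialDeriv l (antidivPotential v l)) volume := fun l =>
    ((isSmooth_antidivPotential hv l).partialDeriv l).continuous.aestronglyMeasurable
  have e : antidivDiv v = ∑ l : d, Torus.partialDeriv l (antidivPotential v l) := by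
    funext y; simp [antidivDiv, Finset.sum_apply]
  rw [e]
  calc eLpNorm (∑ l : d, Torus.partialDeriv l (antidivPotential v l)) p volume
      ≤ ∑ l : d, eLpNorm (Torus.partialDeriv l (antidivPotential v l)) p volume :=
        eLpNorm_sum_le (fun l _ => hmeas l) hp
    _ ≤ ∑ _l : d, (K : ℝ≥0∞) * eLpNorm v p volume :=
        Finset.sum_le_sum fun l _ => eLpNorm_partialDeriv_antidivPotential_le_of_bound hK hv l l
    _ = ((Fintype.card d * K : ℝ≥0) : ℝ≥0∞) * eLpNorm v p volume := by
        rw [Finset.sum_const, Finset.card_univ, nsmul_eq_mul, ← mul_assoc]; push_cast; ring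

end OrderMinusOne

/-! ## The third-order piece `∂ᵢ∂ⱼΔ⁻¹D`: the three regimes -/

section ThirdOrder

variable [Nonempty d]

/-- `1 < p < ∞`: `‖∂ᵢ∂ⱼΔ⁻¹D‖_p ≤ K ‖v‖_p` (Calderón–Zygmund for `φ = Δ⁻¹D` with `Δφ = D`, then the
order `-1` bound for `D`). [cite: CheskidovLuo2022, §7.2 proof of Thm. 7.3] -/
theorem exists_eLpNorm_hessian_antidivPhi_le_of_one_lt {p : ℝ≥0∞} (hp1 : 1 < p) (hp : p < ⊤) :
    ∃ K : ℝ≥0, ∀ v : UnitAddTorus d → EuclideanSpace ℝ d, IsSmooth v → ∀ i j : d,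
      eLpNorm (Torus.partialDeriv i (Torus.partialDeriv j (antidivPhi v))) p volume ≤ K * eLpNorm v p volume := by
  obtain ⟨C, hC⟩ := eLpNorm_hessian_le_laplacian_holds (d := d) p hp1 hp
  obtain ⟨K, hK⟩ := exists_eLpNorm_partialDeriv_invLaplacian_le (d := d) hp1.le
  refine ⟨C * (Fintype.card d * K), fun v hv i j => ?_⟩
  have hφ : IsSmooth (antidivPhi v) := isSmooth_antidivPhi hv
  have e : Torus.laplacian (antidivPhi v) = antidivDiv v := funext (laplacian_antidivPhi hv)
  calc eLpNorm (Torus.partialDeriv i (Torus.partialDeriv j (antidivPhi v))) p volume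
      ≤ C * eLpNorm (Torus.laplacian (antidivPhi v)) p volume := hC _ hφ i j
    _ ≤ C * ((Fintype.card d * K : ℝ≥0) * eLpNorm v p volume) := by
        rw [e]; exact mul_le_mul' le_rfl (eLpNorm_antidivDiv_le_of_bound hp1.le hK hv)
    _ = ((C * (Fintype.card d * K) : ℝ≥0) : ℝ≥0∞) * eLpNorm v p volume := by push_cast; ring

/-- `p = ∞`: `‖∂ᵢ∂ⱼΔ⁻¹D‖_∞ ≤ K ‖v‖_∞` (the sup bound `Torus.exists_enorm_partialDeriv_partialDeriv_le`
for `φ = Δ⁻¹D`, `∂ₘΔφ = ∂ₘD = Σₗ ∂ₘ∂ₗΔ⁻¹vₗ`, Calderón–Zygmund at `q = d + 2` for each `Δ⁻¹vₗ`, and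
`‖ΔΔ⁻¹vₗ‖_q ≤ 2‖vₗ‖_q ≤ 2‖v‖_∞`). [cite: CheskidovLuo2022, §7.2 proof of Thm. 7.3] -/
theorem exists_eLpNorm_top_hessian_antidivPhi_le :
    ∃ K : ℝ≥0, ∀ v : UnitAddTorus d → EuclideanSpace ℝ d, IsSmooth v → ∀ i j : d,
      eLpNorm (Torus.partialDeriv i (Torus.partialDeriv j (antidivPhi v))) ⊤ volume ≤ K * eLpNorm v ⊤ volume := by
  set q : ℝ≥0∞ := ENNReal.ofReal ((Fintype.card d : ℝ) + 2) with hq_def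
  have hq1 : (1 : ℝ≥0∞) < q := one_lt_card_add_two d
  obtain ⟨K, hK⟩ := exists_enorm_partialDeriv_partialDeriv_le (d := d)
  obtain ⟨C, hC⟩ := eLpNorm_hessian_le_laplacian_holds (d := d) q hq1 (by rw [hq_def]; exact ENNReal.ofReal_lt_top)
  refine ⟨K * (Fintype.card d * (Fintype.card d * (C * 2))), fun v hv i j => ?_⟩
  have hφ : IsSmooth (antidivPhi v) := isSmooth_antidivPhi hv
  have hu : ∀ l, IsSmooth (antidivPotential v l) := isSmooth_antidivPotential hv
  have hvm : AEStronglyMeasurable v volume := hv.continuous.aestronglyMeasurable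
  have e : Torus.laplacian (antidivPhi v) = antidivDiv v := funext (laplacian_antidivPhi hv)
  -- `∂ₘD = Σₗ ∂ₘ∂ₗΔ⁻¹vₗ` and its `L^q` bound
  have hD : ∀ m, eLpNorm (Torus.partialDeriv m (antidivDiv v)) q volume ≤
      (Fintype.card d * (C * 2) : ℝ≥0) * eLpNorm v ⊤ volume := by
    intro m
    have em : Torus.partialDeriv m (antidivDiv v) =
        ∑ l, Torus.partialDeriv m (Torus.partialDeriv l (antidivPotential v l)) := by
      funext y
      rw [Finset.sum_apply]
      exact partialDeriv_finset_sum _ (fun l _ => ((hu l).partialDeriv l).isContDiff (by simp)) m y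
    have hl : ∀ l, eLpNorm (Torus.partialDeriv m (Torus.partialDeriv l (antidivPotential v l))) q volume ≤
        (C * 2 : ℝ≥0) * eLpNorm v ⊤ volume := by
      intro l
      have el : Torus.laplacian (antidivPotential v l) = fun y => v y l - ∫ z, v z l :=
        funext (laplacian_invLaplacian (hv.apply l))
      have hvl : AEStronglyMeasurable (fun y => v y l) volume := (hv.apply l).continuous.aestronglyMeasurable
      calc eLpNorm (Torus.partialDeriv m (Torus.partialDeriv l (antidivPotential v l))) q volume
          ≤ C * eLpNorm (Torus.laplacian (antidivPotential v l)) q volume := hC _ (hu l) m l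
        _ ≤ C * (2 * eLpNorm (fun y => v y l) q volume) := by
            rw [el]; exact mul_le_mul' le_rfl (eLpNorm_sub_integral_le_two_mul hvl hq1.le)
        _ ≤ C * (2 * eLpNorm v ⊤ volume) :=
            mul_le_mul' le_rfl (mul_le_mul' le_rfl
              ((eLpNorm_le_eLpNorm_of_exponent_le le_top hvl).trans (eLpNorm_apply_le v l ⊤)))
        _ = ((C * 2 : ℝ≥0) : ℝ≥0∞) * eLpNorm v ⊤ volume := by push_cast; ring
    rw [em]
    calc eLpNorm (∑ l, Torus.partialDeriv m (Torus.partialDeriv l (antidivPotential v l))) q volume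
        ≤ ∑ l, eLpNorm (Torus.partialDeriv m (Torus.partialDeriv l (antidivPotential v l))) q volume :=
          eLpNorm_sum_le (fun l _ => (((hu l).partialDeriv l).partialDeriv m).continuous.aestronglyMeasurable) hq1.le
      _ ≤ ∑ _l : d, ((C * 2 : ℝ≥0) : ℝ≥0∞) * eLpNorm v ⊤ volume := Finset.sum_le_sum fun l _ => hl l
      _ = ((Fintype.card d * (C * 2) : ℝ≥0) : ℝ≥0∞) * eLpNorm v ⊤ volume := by
          rw [Finset.sum_const, Finset.card_univ, nsmul_eq_mul]; push_cast; ring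
  refine eLpNorm_top_le_of_forall_enorm_le fun x => ?_
  calc ‖Torus.partialDeriv i (Torus.partialDeriv j (antidivPhi v)) x‖ₑ
      ≤ K * ∑ m, eLpNorm (Torus.partialDeriv m (Torus.laplacian (antidivPhi v))) q volume := hK _ hφ i j x
    _ ≤ K * ∑ _m : d, ((Fintype.card d * (C * 2) : ℝ≥0) : ℝ≥0∞) * eLpNorm v ⊤ volume := by
        rw [e]; exact mul_le_mul' le_rfl (Finset.sum_le_sum fun m _ => hD m)
    _ = ((K * (Fintype.card d * (Fintype.card d * (C * 2))) : ℝ≥0) : ℝ≥0∞) * eLpNorm v ⊤ volume := by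
        rw [Finset.sum_const, Finset.card_univ, nsmul_eq_mul]; push_cast; ring

/-- **The adjoint identity for the third-order piece**:
`∫ (∂ᵢ∂ⱼΔ⁻¹D) ψ = -Σₗ ∫ vₗ · ∂ₗΔ⁻¹Δ⁻¹∂ⱼ∂ᵢψ` for smooth `v`, `ψ` (two integrations by parts,
the symmetry of `Δ⁻¹`, `D = Σₗ ∂ₗΔ⁻¹vₗ`, one more integration by parts and symmetry, and
`Δ⁻¹∂ₗ = ∂ₗΔ⁻¹`; Cheskidov–Luo 2022, proof of Thm. 7.3, `p = 1`).
[cite: CheskidovLuo2022, §7.2 proof of Thm. 7.3] -/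
theorem integral_hessian_antidivPhi_mul (hv : IsSmooth v) {ψ : UnitAddTorus d → ℝ} (hψ : IsSmooth ψ)
    (i j : d) :
    ∫ x, Torus.partialDeriv i (Torus.partialDeriv j (antidivPhi v)) x * ψ x =
      -∑ l, ∫ x, v x l *
        Torus.partialDeriv l (invLaplacian (invLaplacian (Torus.partialDeriv j (Torus.partialDeriv i ψ)))) x := by
  have hD : IsSmooth (antidivDiv v) := isSmooth_antidivDiv hv
  have hφ : IsSmooth (antidivPhi v) := isSmooth_antidivPhi hv
  have hu : ∀ l, IsSmooth (antidivPotential v l) := isSmooth_antidivPotential hv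
  have hψij : IsSmooth (Torus.partialDeriv j (Torus.partialDeriv i ψ)) := (hψ.partialDeriv i).partialDeriv j
  set Ψ := invLaplacian (Torus.partialDeriv j (Torus.partialDeriv i ψ)) with hΨ_def
  have hΨ : IsSmooth Ψ := isSmooth_invLaplacian hψij
  -- two integrations by parts and the symmetry of `Δ⁻¹`
  have h1 : ∫ x, Torus.partialDeriv i (Torus.partialDeriv j (antidivPhi v)) x * ψ x =
      ∫ x, antidivDiv v x * Ψ x := by
    rw [integral_partialDeriv_mul_eq_neg' (hφ.partialDeriv j) hψ i,
      integral_partialDeriv_mul_eq_neg' hφ (hψ.partialDeriv i) j, neg_neg]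
    exact integral_invLaplacian_mul_comm hD hψij
  -- expand `D = Σₗ ∂ₗuₗ`, integrate by parts and use the symmetry once more
  have h2 : ∫ x, antidivDiv v x * Ψ x = ∑ l, ∫ x, Torus.partialDeriv l (antidivPotential v l) x * Ψ x := by
    simp only [antidivDiv, Finset.sum_mul]
    exact integral_finsetSum _ fun l _ =>
      (((hu l).partialDeriv l).continuous.mul hΨ.continuous).integrable_unitAddTorus
  have h3 : ∀ l, ∫ x, Torus.partialDeriv l (antidivPotential v l) x * Ψ x =
      -∫ x, v x l * Torus.partialDeriv l (invLaplacian Ψ) x := by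
    intro l
    rw [integral_partialDeriv_mul_eq_neg' (hu l) hΨ l]
    have hs : ∫ x, antidivPotential v l x * Torus.partialDeriv l Ψ x =
        ∫ x, v x l * invLaplacian (Torus.partialDeriv l Ψ) x :=
      integral_invLaplacian_mul_comm (hv.apply l) (hΨ.partialDeriv l)
    rw [hs]
    congr 2
    funext x
    rw [partialDeriv_invLaplacian hΨ l x]
  rw [h1, h2, ← Finset.sum_neg_distrib]
  exact Finset.sum_congr rfl fun l _ => h3 l

/-- `p = 1`: `‖∂ᵢ∂ⱼΔ⁻¹D‖_{L¹} ≤ K ‖v‖_{L¹}`, by duality from the adjoint identity and the sup bound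
`Torus.exists_enorm_partialDeriv_invLaplacian_invLaplacian_le`. [cite: CheskidovLuo2022, §7.2 proof of Thm. 7.3] -/
theorem exists_eLpNorm_one_hessian_antidivPhi_le :
    ∃ K : ℝ≥0, ∀ v : UnitAddTorus d → EuclideanSpace ℝ d, IsSmooth v → ∀ i j : d,
      eLpNorm (Torus.partialDeriv i (Torus.partialDeriv j (antidivPhi v))) 1 volume ≤ K * eLpNorm v 1 volume := by
  obtain ⟨M, hM⟩ := exists_enorm_partialDeriv_invLaplacian_invLaplacian_le (d := d)
  refine ⟨Fintype.card d * M, fun v hv i j => ?_⟩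
  have hh : IsSmooth (Torus.partialDeriv i (Torus.partialDeriv j (antidivPhi v))) :=
    ((isSmooth_antidivPhi hv).partialDeriv j).partialDeriv i
  refine eLpNorm_one_le_of_forall_integral_mul_le hh fun ψ hψ hψ1 => ?_
  rw [integral_hessian_antidivPhi_mul hv hψ i j, enorm_neg]
  have hψtop : eLpNorm ψ ⊤ volume ≤ 1 := eLpNorm_top_le_of_forall_enorm_le fun x => by
    rw [← ofReal_norm, Real.norm_eq_abs, ← ENNReal.ofReal_one]
    exact ENNReal.ofReal_le_ofReal (hψ1 x)
  have hw : ∀ (l : d) (x : UnitAddTorus d),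
      ‖Torus.partialDeriv l (invLaplacian (invLaplacian (Torus.partialDeriv j (Torus.partialDeriv i ψ)))) x‖ₑ ≤ M :=
    fun l x => (hM ψ hψ l j i x).trans (by simpa using mul_le_mul' (le_refl (M : ℝ≥0∞)) hψtop)
  calc ‖∑ l, ∫ x, v x l * Torus.partialDeriv l (invLaplacian (invLaplacian (Torus.partialDeriv j (Torus.partialDeriv i ψ)))) x‖ₑ
      ≤ ∑ l, ‖∫ x, v x l * Torus.partialDeriv l (invLaplacian (invLaplacian (Torus.partialDeriv j (Torus.partialDeriv i ψ)))) x‖ₑ :=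
        enorm_sum_le _ _
    _ ≤ ∑ l, (M : ℝ≥0∞) * eLpNorm (fun x => v x l) 1 volume := Finset.sum_le_sum fun l _ =>
        enorm_integral_mul_le_of_forall_enorm_le (hv.apply l).continuous.aestronglyMeasurable (hw l)
    _ ≤ ∑ _l : d, (M : ℝ≥0∞) * eLpNorm v 1 volume :=
        Finset.sum_le_sum fun l _ => mul_le_mul' le_rfl (eLpNorm_apply_le v l 1)
    _ = ((Fintype.card d * M : ℝ≥0) : ℝ≥0∞) * eLpNorm v 1 volume := by
        rw [Finset.sum_const, Finset.card_univ, nsmul_eq_mul]; push_cast; ring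

/-- **`∂ᵢ∂ⱼΔ⁻¹D = Σₗ Δ⁻²∂ᵢ∂ⱼ∂ₗvₗ` is bounded on `L^p(T^d)` for every `1 ≤ p ≤ ∞`** (Cheskidov–Luo
2022, Thm. 7.3, the operator `Δ⁻¹Δ⁻¹∂ᵢ∂ⱼ∂ₖ`). [cite: CheskidovLuo2022, §7.2 Thm. 7.3] -/
theorem exists_eLpNorm_hessian_antidivPhi_le {p : ℝ≥0∞} (hp : 1 ≤ p) :
    ∃ K : ℝ≥0, ∀ v : UnitAddTorus d → EuclideanSpace ℝ d, IsSmooth v → ∀ i j : d,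
      eLpNorm (Torus.partialDeriv i (Torus.partialDeriv j (antidivPhi v))) p volume ≤ K * eLpNorm v p volume := by
  rcases eq_or_lt_of_le hp with rfl | hp1
  · exact exists_eLpNorm_one_hessian_antidivPhi_le
  rcases eq_or_lt_of_le (le_top : p ≤ ⊤) with rfl | hptop
  · exact exists_eLpNorm_top_hessian_antidivPhi_le
  exact exists_eLpNorm_hessian_antidivPhi_le_of_one_lt hp1 hptop

end ThirdOrder

/-! ## Entries, the tensor, and the discharge -/

section Assembly

/-- **`L^p` bound for one entry of `ℛv`**, `1 ≤ p ≤ ∞`, from the two operator bounds with constants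
`K₁` (order `-1`) and `K₂` (third order). [cite: CheskidovLuo2022, §7.2 Thm. 7.3] -/
theorem eLpNorm_antidivEntry_le_of_bounds [Nonempty d] {p : ℝ≥0∞} (hp : 1 ≤ p) {K₁ K₂ : ℝ≥0}
    (hK₁ : ∀ g : UnitAddTorus d → ℝ, IsSmooth g → ∀ i : d,
      eLpNorm (Torus.partialDeriv i (invLaplacian g)) p volume ≤ K₁ * eLpNorm g p volume)
    (hK₂ : ∀ w : UnitAddTorus d → EuclideanSpace ℝ d, IsSmooth w → ∀ i j : d,
      eLpNorm (Torus.partialDeriv i (Torus.partialDeriv j (antidivPhi w))) p volume ≤ K₂ * eLpNorm w p volume)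
    (hv : IsSmooth v) (i j : d) :
    eLpNorm (antidivEntry v i j) p volume ≤
      ((2 * K₁ + Real.toNNReal |1 / ((Fintype.card d : ℝ) - 1)| * (Fintype.card d * K₁) +
        Real.toNNReal |(2 - (Fintype.card d : ℝ)) / ((Fintype.card d : ℝ) - 1)| * K₂ : ℝ≥0) : ℝ≥0∞) *
        eLpNorm v p volume := by
  set N : ℝ := (Fintype.card d : ℝ) with hN
  set c₁ : ℝ := 1 / (N - 1) with hc₁
  set c₂ : ℝ := (2 - N) / (N - 1) with hc₂
  -- the four pieces
  set f₁ := Torus.partialDeriv i (antidivPotential v j) with hf₁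
  set f₂ := Torus.partialDeriv j (antidivPotential v i) with hf₂
  set f₃ : UnitAddTorus d → ℝ := fun y => c₁ * (if i = j then antidivDiv v y else 0) with hf₃
  set f₄ : UnitAddTorus d → ℝ :=
    fun y => c₂ * Torus.partialDeriv i (Torus.partialDeriv j (antidivPhi v)) y with hf₄
  have hm₁ : AEStronglyMeasurable f₁ volume :=
    ((isSmooth_antidivPotential hv j).partialDeriv i).continuous.aestronglyMeasurable
  have hm₂ : AEStronglyMeasurable f₂ volume :=
    ((isSmooth_antidivPotential hv i).partialDeriv j).continuous.aestronglyMeasurable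
  have hm₃ : AEStronglyMeasurable f₃ volume :=
    (isSmooth_ite_antidivDiv hv i j).continuous.aestronglyMeasurable.const_mul _
  have hm₄ : AEStronglyMeasurable f₄ volume :=
    (((isSmooth_antidivPhi hv).partialDeriv j).partialDeriv i).continuous.aestronglyMeasurable.const_mul _
  have e : antidivEntry v i j = fun y => ((f₁ y + f₂ y) - f₃ y) + f₄ y := rfl
  -- bounds
  have b₁ : eLpNorm f₁ p volume ≤ K₁ * eLpNorm v p volume :=
    eLpNorm_partialDeriv_antidivPotential_le_of_bound hK₁ hv i j
  have b₂ : eLpNorm f₂ p volume ≤ K₁ * eLpNorm v p volume :=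
    eLpNorm_partialDeriv_antidivPotential_le_of_bound hK₁ hv j i
  have b₃ : eLpNorm f₃ p volume ≤
      (Real.toNNReal |c₁| * (Fintype.card d * K₁) : ℝ≥0) * eLpNorm v p volume := by
    have e3 : f₃ = c₁ • fun y => (if i = j then antidivDiv v y else 0) := rfl
    rw [e3, eLpNorm_const_smul, Real.enorm_eq_ofReal_abs, ENNReal.ofReal, ENNReal.coe_mul, mul_assoc]
    refine mul_le_mul' le_rfl ?_
    by_cases hij : i = j
    · simp only [hij, if_true]; exact eLpNorm_antidivDiv_le_of_bound hp hK₁ hv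
    · simp only [hij, if_false, eLpNorm_zero']; exact bot_le
  have b₄ : eLpNorm f₄ p volume ≤ (Real.toNNReal |c₂| * K₂ : ℝ≥0) * eLpNorm v p volume := by
    have e4 : f₄ = c₂ • Torus.partialDeriv i (Torus.partialDeriv j (antidivPhi v)) := rfl
    rw [e4, eLpNorm_const_smul, Real.enorm_eq_ofReal_abs, ENNReal.ofReal, ENNReal.coe_mul, mul_assoc]
    exact mul_le_mul' le_rfl (hK₂ v hv i j)
  -- Minkowski
  rw [e]
  calc eLpNorm (fun y => ((f₁ y + f₂ y) - f₃ y) + f₄ y) p volume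
      ≤ eLpNorm (fun y => (f₁ y + f₂ y) - f₃ y) p volume + eLpNorm f₄ p volume :=
        eLpNorm_add_le ((hm₁.add hm₂).sub hm₃) hm₄ hp
    _ ≤ (eLpNorm (fun y => f₁ y + f₂ y) p volume + eLpNorm f₃ p volume) + eLpNorm f₄ p volume := by
        gcongr; exact eLpNorm_sub_le (hm₁.add hm₂) hm₃ hp
    _ ≤ ((eLpNorm f₁ p volume + eLpNorm f₂ p volume) + eLpNorm f₃ p volume) + eLpNorm f₄ p volume := by
        gcongr; exact eLpNorm_add_le hm₁ hm₂ hp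
    _ ≤ (((K₁ : ℝ≥0∞) * eLpNorm v p volume + K₁ * eLpNorm v p volume) +
          (Real.toNNReal |c₁| * (Fintype.card d * K₁) : ℝ≥0) * eLpNorm v p volume) +
          (Real.toNNReal |c₂| * K₂ : ℝ≥0) * eLpNorm v p volume := by
        gcongr
    _ = _ := by
        rw [← add_mul, ← add_mul, ← add_mul]
        push_cast
        ring

/-- **`ℛ` is bounded on `L^p(𝕋^d)` for every `1 ≤ p ≤ ∞`, `d ≥ 2`** (Cheskidov–Luo 2022, Thm. 7.3;
here for all smooth `v`, the zero-mean restriction being unnecessary): `‖ℛv‖_{L^p} ≤ C ‖v‖_{L^p}`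
with `C` depending on `d` and `p` only. [cite: CheskidovLuo2022, §7.2 Thm. 7.3] -/
theorem exists_eLpNorm_antidivergence_le (hd : 2 ≤ Fintype.card d) {p : ℝ≥0∞} (hp : 1 ≤ p) :
    ∃ C : ℝ≥0, ∀ v : UnitAddTorus d → EuclideanSpace ℝ d, IsSmooth v →
      eLpNorm (antidivergence v) p volume ≤ C * eLpNorm v p volume := by
  haveI : Nonempty d := Fintype.card_pos_iff.1 (by omega)
  obtain ⟨K₁, hK₁⟩ := exists_eLpNorm_partialDeriv_invLaplacian_le (d := d) hp
  obtain ⟨K₂, hK₂⟩ := exists_eLpNorm_hessian_antidivPhi_le (d := d) hp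
  set K : ℝ≥0 := 2 * K₁ + Real.toNNReal |1 / ((Fintype.card d : ℝ) - 1)| * (Fintype.card d * K₁) +
    Real.toNNReal |(2 - (Fintype.card d : ℝ)) / ((Fintype.card d : ℝ) - 1)| * K₂ with hK
  refine ⟨Fintype.card d * Fintype.card d * K, fun v hv => ?_⟩
  have hent : ∀ i j, eLpNorm (antidivEntry v i j) p volume ≤ (K : ℝ≥0∞) * eLpNorm v p volume :=
    fun i j => eLpNorm_antidivEntry_le_of_bounds hp hK₁ hK₂ hv i j
  have hmeas : ∀ i j, AEStronglyMeasurable (fun y => |antidivEntry v i j y|) volume := fun i j =>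
    (isSmooth_antidivEntry hv i j).continuous.abs.aestronglyMeasurable
  have hpt : ∀ y, ‖antidivergence v y‖ ≤ ∑ q : d × d, |antidivEntry v q.2 q.1 y| := by
    intro y
    refine (norm_tensor_le_sum_sum_abs (antidivergence v y)).trans (le_of_eq ?_)
    rw [Fintype.sum_prod_type]
    simp [antidivergence_apply]
  have e : (fun y => ∑ q : d × d, |antidivEntry v q.2 q.1 y|) =
      ∑ q : d × d, fun y => |antidivEntry v q.2 q.1 y| :=
    (Finset.sum_fn _ _).symm
  calc eLpNorm (antidivergence v) p volume
      ≤ eLpNorm (fun y => ∑ q : d × d, |antidivEntry v q.2 q.1 y|) p volume := eLpNorm_mono_real hpt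
    _ = eLpNorm (∑ q : d × d, fun y => |antidivEntry v q.2 q.1 y|) p volume := by rw [e]
    _ ≤ ∑ q : d × d, eLpNorm (fun y => |antidivEntry v q.2 q.1 y|) p volume :=
        eLpNorm_sum_le (fun q _ => hmeas q.2 q.1) hp
    _ = ∑ q : d × d, eLpNorm (antidivEntry v q.2 q.1) p volume :=
        Finset.sum_congr rfl fun q _ => eLpNorm_norm (antidivEntry v q.2 q.1)
    _ ≤ ∑ _q : d × d, (K : ℝ≥0∞) * eLpNorm v p volume := Finset.sum_le_sum fun q _ => hent q.2 q.1
    _ = ((Fintype.card d * Fintype.card d * K : ℝ≥0) : ℝ≥0∞) * eLpNorm v p volume := by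
        rw [Finset.sum_const, Finset.card_univ, Fintype.card_prod, nsmul_eq_mul]
        push_cast
        ring

/-- **Discharge of the named fact `Torus.antidivergence_Lp_bound d`** — Cheskidov–Luo 2022,
Thm. 7.3: for `d ≥ 2` and `1 ≤ p ≤ ∞` there is `C` with `‖ℛv‖_{L^p(𝕋^d)} ≤ C ‖v‖_{L^p(𝕋^d)}` for
all smooth zero-mean `v : 𝕋^d → ℝ^d`. [cite: CheskidovLuo2022, §7.2 Thm. 7.3] -/
theorem antidivergence_Lp_bound_holds : antidivergence_Lp_bound d := by
  intro hd p hp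
  obtain ⟨C, hC⟩ := exists_eLpNorm_antidivergence_le (d := d) hd hp
  exact ⟨C, fun v hv _ => hC v hv⟩

end Assembly

end Torus

end Literature.Analysis.FluidPDE
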